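import Literature.MathematicalPhysics.QuantumFieldTheory.Balaban1983to89.Node00.CarriersZRegSound

/-!
# NODE 00 (YM-PLAN Track A) — A GAUGE-INVARIANT, RAY-EXACT OBJECT-LEVEL PIN of the residual regularity datum `ζ.R` of the
# [Balaban1985Variational] group of record: the five numbers of n07-a's `RegCarrierT` at `(U, □)` := THE OPTIMAL REGULARITY CONSTANT of `(U, □)` —
# the infimum over ALL local gauges of one scalar majorant of print's (9)–(10) members — so that the TYPED regularity clause of Theorem 1 at the pin
# is SOUND for print's ∃u-sentence at all thresholds and EQUIVALENT to it on the ray `B₄ = ρB₃`; what it does not do, said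

NODE 00 CARRIER MODULE (seat `pub-ymgap-node00-def-B11` g4, 2026-08-27; director-ym R141 (A) row «is `CarriersZ` the B11 pin?» — ANSWER OF RECORD: IT IS
(`Node00/CarriersZ.lean`, bundle `Z11OfRecord F N ζ`); this module is the THIRD COMPANION that answer names, after g2's `Node00/CarriersZSectE.lean` (the Sect. E
presentation pin `withSectE`) and g3's `Node00/CarriersZRegSound.lean` (the SOUNDNESS LAW `RegSound` of the regularity data — interface finding F8, soundness half).
APPEND-ONLY: a NEW importing module; `CarriersZ`, `CarriersZSectE`, `CarriersZRegSound`, n07-e's `CriticalOfRecord`, n07-a's `B11Thm1CarrierT`, n05-e's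
`B11Reg910Classes` are untouched and CONSUMED BY NAME.  [Balaban1985Variational] = T. Bałaban, *The variational problem and background fields in renormalization
group method for lattice gauge theories*, Commun. Math. Phys. **102** (1985) 277–309 (cell paper B11); [Balaban1985BackgroundPropagators] = CMP **99** (1985)
389–434 (B9); [Balaban1985RegularSpaces] = CMP **99** (1985) 75–102 (B8).

WHY.  The typed Theorem 1 (`B11Thm1.Thm1At`, read at NODE 00's objects through n07-a's `varProblemT F N K k R`) states its regularity conclusion (9)–(10) as the
clause `B11.Regularity`: «`R.Gauged U □` and `R.normA U □ < B₃Mε₁ξ⁻¹`, `R.normGradA U □ < B₃Mε₁ξ⁻²`, `R.holderA U □ β < B₄Mε₁ξ^{-(2+β)}` (`0 ≤ β ≤ 1`),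
`R.normLapA U □ < B₃Mε₁ξ⁻³`» (`ξ = Lʲη`), the five fields of the regularity datum `R : RegCarrierT F N K` being FREE DATA of the residual layer `ζ : ResidZ F N`
(`ζ.R`).  Print (p. 279) says instead: «there exists a gauge transformation u defined on a neighborhood of □ and such that on □ Uᵘ = e^{iηA}» with those five
bounds on `A` — an ∃u-SENTENCE ABOUT OBJECTS, typed by n05-e as `B11Reg910Classes.Reg910T F N K k U □ j dist C C₄ β₀`.  Interface finding F8 (g0): `R` is
object-level-UNPINNED; g3 typed the soundness law and recorded the DESIGN FACT that no gauge-free choice of five numbers makes the typed clause EQUIVALENT to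
print's sentence AT ALL THRESHOLDS `(B₃, B₄)` (orthant versus union of orthants), concluding that every faithful pin is gauge-FIXED ([Balaban1985RegularSpaces]
Thm 2 as a map — not in the tree) and leaving the completeness half UNOWNED (n07-e g3's residual census).  THIS MODULE TYPES THE COMPLETENESS HALF IN THE ONE
FORM THAT NEEDS NO GAUGE MAP: Theorem 1 is consumed at ONE pair of constants `(B₃, B₄(β₀))`, fixed by print BEFORE the member (p. 279: «The constants a₀, a₁, B₃
depend on d and L only, the constants B₄(β₀), M(ε₁) depend on the indicated parameters also»), i.e. on ONE RAY `B₄ = ρB₃` of the threshold plane; and ON A RAY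
ONE SCALAR SUFFICES: scale print's five members by a single majorant `s` — `|A| < sξ⁻¹`, `|∇^η A| < sξ⁻²`, Hölder `< ρ·s·ξ^{-(2+β)}`, `|∂^{η*}∂^η A|, |Δ^η A| <
sξ⁻³` — and let `regConst (U, □) := inf {s ≥ 0 | some gauge u of unitary type with Uᵘ = e^{iηA} on □ achieves the majorant s}` («THE OPTIMAL REGULARITY
CONSTANT»).  The pin reads `Gauged U □ :=` «the set is non-empty» and the five numbers `:= regConst·ξ⁻¹`, `regConst·ξ⁻²`, `ρ·regConst·ξ^{-(2+β)}`, `regConst·ξ⁻³`.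
Then (i) SOUNDNESS at ALL thresholds: the typed clause at the pin says `regConst < B₃Mε₁ ∧ ρ·regConst < B₄Mε₁`, so some admissible `s` below both thresholds
exists (`csInf_lt_iff`) and its gauge witnesses print's sentence (`Reg910Cube.mono`); (ii) COMPLETENESS ON THE RAY: a gauge witnessing print's sentence at
`(C, ρC)` witnesses the majorant `s` for some `s < C` STRICTLY — because the torus is FINITE (finitely many bonds and pairs in `□`, each member strict) and the
Hölder weights `(ξ/dist)^β`, `0 ≤ β ≤ 1`, are dominated by their endpoints `β ∈ {0, 1}` (`t^β ≤ max 1 t`) — so `regConst < C`.  g3's design fact is RESPECTED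
(off the ray the pin is sound and complete only up to `max (B₃, B₄/ρ)`), and nothing of [Balaban1985RegularSpaces] Thm 2 ∕ Sect. F (159) is used or claimed.

WHAT.  §1 (generic, over n05-e's one-cube class `Reg910Cube`: structure maps `T`, a units-valued bond field `U` of a complete normed ℂ-algebra `𝔸`):
`regConstSet T U η □ ξ dist ρ := {s | 0 ≤ s ∧ Reg910Cube T U η □ ξ dist s (ρs) 1}`, `regConst := sInf regConstSet`; `regConstSet_bddBelow`, `regConst_nonneg`,
`mem_regConstSet_of_le` (an upper set, `Reg910Cube.mono`); SOUNDNESS `reg910Cube_of_regConst_lt` (non-empty ∧ `regConst < C` ∧ `ρ·regConst < C₄` ⇒ `Reg910Cube …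
C C₄ 1`); COMPLETENESS `regConst_le_of_reg910Cube` (`Reg910Cube … C C₄ 1`, `0 ≤ C` ⇒ non-empty ∧ `regConst ≤ max C (C₄/ρ)`) and, on a FINITE site type, the
STRICT form `regConst_lt_of_reg910Cube` (`0 < C` ⇒ `regConst < max C (C₄/ρ)`; tools `rpow_le_max_one_self`, `exists_pos_lt_forall_lt`); non-vacuity `regConst_one`
(`U ≡ 1`: non-empty and `regConst = 0`, n05-e's `reg910Cube_one`); the degenerate value `reg910Cube_empty` ∕ `regConst_empty` (EMPTY site set: every
`U` admissible at every pair of constants, optimal constant `0` — ref-G READ37 (w6), PROVED).  §2 (at NODE 00's objects: fibre `M_N(ℂ)` via `toPV`, structure maps `shiftEquiv` of the finest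
torus `Site (F.P K) 0` — a `Fintype` — `η := (F.P K).eta k`, `ξ := scaleLen F.L η j`): `RegCubesT F K` (THE CUBE CLASS AS DATA: abstract cubes `Q`, each read as a
site set `carrier q` with index `scale q` and size parameter `sizeM q`, plus the η-scale distance `dist` — n07-a's abstract `Cube ∕ scale ∕ sizeM` together with g3's
`RegGeomT` slot); `regConstT`, `GaugedT`; ★ THE PIN `regPinT F N K k ρ g : RegCarrierT F N K`; the unfolding `regularity_regPinT_iff` (typed clause at the pin ↔
`GaugedT ∧ regConstT < B₃Mε₁ ∧ ρ·regConstT < B₄Mε₁` — thresholds matched LITERALLY: `varProblemT`'s `L^{scale □}·η` is `scaleLen F.L η (scale □)` by `rfl`, the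
common factors `ξ⁻¹ⁿ > 0` cancel); ★ SOUNDNESS `reg910T_of_regularity_regPinT` (typed clause at the pin ⇒ `Reg910T F N K k U (g.carrier q) (g.scale q) g.dist (B₃Mε₁)
(B₄Mε₁) 1`, ALL thresholds); ★★ EXACTNESS ON THE RAY `regularity_regPinT_of_reg910T` ∕ `regularity_regPinT_iff_reg910T` (`0 < B₃Mε₁`: typed clause at `(B₃, ρB₃)`
↔ `Reg910T … (B₃Mε₁) (ρB₃Mε₁) 1`); `reg910_regPinT_iff` (the third conjunct `Reg910` of `Thm1At` at the pin ↔ print's sentence for every minimal `U` and every cube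
with `M ≤ M(ε₁)`); `thm1At_regPinT_iff` (★★ THEOREM 1 AT THE PIN, constants on the ray: `Thm1At C (varProblemT … (regPinT …)) ↔` (8) ∧ uniqueness-in-(6) — n07-a's
`Exists8` ∕ `Unique6`, which do not read `R` (`exists8_iff`, `unique6_iff`) — ∧ print's (9)–(10) sentence); the off-ray normalisation `constsOnRay`,
`thm1At_regPinT_onRay` (typed Theorem 1 at the pin with ANY constants ⇒ with the constants moved onto the ray, `B₄ := ρB₃`); the consumed currency
`reg336Cube_of_regularity_regPinT` ([Balaban1985BackgroundPropagators] (3.35)–(3.36), n05-e's `Reg910Cube.reg336Cube`); non-vacuity `regularity_regPinT_one` (the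
typed clause HOLDS at `U = 1` on every cube with positive thresholds: the pin is exercised, `regConst = 0`); the degenerate value
`regularity_regPinT_of_carrier_empty` (a cube read as `∅`: the typed clause holds at the pin for EVERY `U` — (w6), PROVED); `RegCubesT.toRegGeomT` (g3's geometry
slot, filled); small faces `gaugedT_iff`, `gaugedT_and_regConstT_le_of_reg910T` (weak completeness at objects, all thresholds), `scaleLen_record_pos`.
§3 (the residual layer): `ResidZ.pinReg ζ ρ g` (the layer with `R` REPLACED by the pin, everything else unchanged — `rfl` faces), `ResidZ.pinReg_pinCrit` (commutes
with n07-e's criticality pin, `rfl`), `SectEPres.pinReg` ∕ `ResidZ.pinReg_withSectE` (commutes with g2's Sect. E presentation: the presentation reads only `ζ.B₀`,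
`ζ.B₃`, unchanged); ★★ THE HEADLINE `reg910T_of_b11Leaf_pinReg`: AT THE PINNED LAYER THE LEAF ALONE GIVES THEOREM 1's (9)–(10) AS PRINTED (∃u-form) — every member,
every `0 < ε₁ ≤ a₁`, every `V` with (7), every minimal `U` of (5), every cube with `M ≤ M(ε₁)` — g3's headline WITHOUT its displayed hypothesis `(hs : ζ.RegSound g)`
(at the pin, soundness is a THEOREM about the datum, not a law imposed on it); its twin at the triply-pinned layer `((ζ.withSectE E).pinCrit).pinReg ρ g`; and
★★★ `thm1Printed_famV_pinReg_iff`: the leaf's conjunct `t1` AT THE PINNED LAYER (`(Z11OfRecord F N (ζ.pinReg ρ g)).famV = famVOfRecord F N (ζ.pinReg ρ g)`, `rfl`)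
IS EQUIVALENT TO A SENTENCE ABOUT OBJECTS (+ the cube data `g`, the ratio `ρ`): «∃ constants `C` with `C.B₄ = ρ·C.B₃` such that every member satisfies (8),
uniqueness in (6) and print's (9)–(10)» — the junk channel of the ∀-form THROUGH `R` (`CarriersZ.exists_residZ_not_b11Leaf`, `CarriersZRegSound.exists_regSound_not_b11Leaf`:
a never-«gauged» datum kills `t1`) is CLOSED at the pin: `GaugedT` is no longer free data but «U admits a small-field gauge on □».

WHAT STAYS RESIDUAL ∕ WHAT THIS IS NOT, EXPLICITLY: (a) EXACT ON THE RAY ONLY: the ratio `ρ > 0` (print's `B₄(β₀)/B₃` at `β₀ = 1`) is a PARAMETER of the pin,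
chosen by the consumer before the member as print chooses its constants; at thresholds off the ray `B₄ = ρB₃` the pin is SOUND (`reg910T_of_regularity_regPinT`)
and complete only up to `max (B₃, B₄/ρ)` (`regConst_le_of_reg910Cube`) — g3's design fact; a consumer who needs the typed clause at two independent thresholds
needs the gauge-fixed pin ([Balaban1985RegularSpaces] Thm 2 as a map), which is NOT here; (b) NOT `RegSound` in g3's sense: the pin's numbers READ A GAUGE
(`CarriersZRegSound.RegReadsGauge`) iff the infimum is ATTAINED — a compactness statement over the gauge group of `□`, NOT claimed; g3's law, its faces, its
consumers (n07-e's `…N07AtRecord12Sides` §E) and the referees' reader rule stand untouched — this module offers the ALTERNATIVE of reading the leaf at the pinned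
layer, where no law is displayed because none is needed; (c) THE CUBE CLASS `g : RegCubesT F K` STAYS THE CONSUMER'S DATA — print's cubes «□ ⊂ B_j(Λ_j) ∪
B_{j+1}(Λ_{j+1})» of size `2MLʲη` (p. 279) and the η-lattice distance are NOT typed as site sets at NODE 00 (g3's residual (e)); DEGENERATE VALUES SAID AND
PROVED (ref-G READ37 (w6); `reg910Cube_empty`, `regConst_empty`, `regularity_regPinT_of_carrier_empty`): at an EMPTY carrier `g.carrier q = ∅` every member of `Reg910Cube` is vacuous, so the pin says «gauged» with `regConst = 0` and `Reg910T … ∅ …`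
says nothing — a count line in (9)–(10) currency must read `g` from print's cubes or display their non-emptiness; likewise `sizeM q ≤ 0` makes the typed clause
FALSE at the pin (`regConst ≥ 0`), whence the hypotheses `0 < B₃·sizeM q·ε₁` ∕ `0 < g.sizeM q` of the exactness faces; (d) `ζ.IsCrit` is n07-e's (`pinCrit`),
`ζ.famAn` (Sect. G) and the `famLG` presentations beyond Sect. E stay residual — untouched here; (e) (8) and uniqueness-in-(6) are carried BY NAME (`Exists8`,
`Unique6`) — they read objects already (n07-a) and are not re-read here.
HONEST FRAMING: definitions + kernel bookkeeping (`csInf_lt_iff`, `csInf_le`, `Real.sInf_nonneg`, `Reg910Cube.mono`, finiteness of `Site (F.P K) 0`, `Real.rpow`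
endpoint monotonicity, `rfl`s); NO estimate; NOTHING of [Balaban1985Variational] asserted or proved (that minimal configurations HAVE small optimal regularity
constants is Theorem 1 ∕ Sect. F, proved nowhere in the tree); N07 NOT discharged, no count moved; one finite T⁴ programme at fixed ε — NOT continuum ∕ ℝ⁴ ∕
infinite volume ∕ OS ∕ mass gap ∕ Clay.  No `sorry`, no `axiom`, no `opaque`, no `instance`, no `notation`.  Filed `--supports stmt-QuantumFields-19902` (K0′; the
definition lane's lineage tag, dag-lead WORDS-111). -/

noncomputable section

open scoped Matrix.Norms.L2Operator

namespace Literature.MathematicalPhysics.QuantumFieldTheory.Balaban1983to89.Node00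

open T4Continuum AveragingRT T4FiniteEpsInhabited FlowStep FlowStepRuns DagBinding T4DatumAssembly
open B9Eq39Adjoint (covD covDstar curlη divPη fluct)
open B9Eq3117Current (gaugeTr)
open B9Eq335RegularityClasses (Reg336Cube)
open B11Reg910Classes (lapη Reg910Cube Reg910T toPV)
open B11Thm1 (Thm1At Exists8 Unique6)
open B11Thm1CarrierT (RegCarrierT varProblemT)
open LatticeNorms (scaleLen)

/-! ## §1. Generic: the optimal regularity constant of `(U, □)` over n05-e's one-cube class -/

section Generic

variable {𝔸 : Type*} [NormedRing 𝔸] [NormedAlgebra ℂ 𝔸] [CompleteSpace 𝔸] {S : Type*} {ι : Type*} [Fintype ι] [LinearOrder ι]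
variable (T : ι → Equiv.Perm S) (U : ι → S → 𝔸ˣ)

/-- **THE ADMISSIBLE REGULARITY CONSTANTS of `(U, □)`** at scale `ξ`, Hölder ratio `ρ`: the majorants `s ≥ 0` for which SOME gauge transformation `u` of unitary
type on `□` with `Uᵘ = e^{iηA}` on `□` has `|A| < sξ⁻¹`, `|∇^η A| < sξ⁻²`, Hölder quotients `< ρ·s·ξ^{-(2+β)}·dist^β` (`0 ≤ β ≤ 1`), `|∂^{η*}∂^η A|, |Δ^η A| < sξ⁻³`
— n05-e's `Reg910Cube` at the constants `(s, ρs)`, `β₀ = 1`. [cite: Balaban1985Variational, Thm 1 (9)–(10) p.279 («there exists a gauge transformation u … such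
that on □ Uᵘ = e^{iηA}, |A|, |∇^η A| < B₃Mε₁(Lʲη)⁻¹⁽²⁾ …»)] -/
def regConstSet (η : ℝ) (cube : Set S) (ξ : ℝ) (dist : S → S → ℝ) (ρ : ℝ) : Set ℝ :=
  {s : ℝ | 0 ≤ s ∧ Reg910Cube T U η cube ξ dist s (ρ * s) 1}

/-- **THE OPTIMAL REGULARITY CONSTANT of `(U, □)`**: the infimum of the admissible majorants (`sInf`; `0` when there is none — the pin reads admissibility
separately, `GaugedT`). A GAUGE-INVARIANT functional of `(U, □)`: no gauge is chosen. [cite: Balaban1985Variational, Thm 1 (9)–(10) p.279] -/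
def regConst (η : ℝ) (cube : Set S) (ξ : ℝ) (dist : S → S → ℝ) (ρ : ℝ) : ℝ :=
  sInf (regConstSet T U η cube ξ dist ρ)

variable {T U}

/-- The admissible majorants are bounded below by `0`. [cite: Balaban1985Variational, (9)–(10) p.279 (bookkeeping)] -/
theorem regConstSet_bddBelow (η : ℝ) (cube : Set S) (ξ : ℝ) (dist : S → S → ℝ) (ρ : ℝ) :
    BddBelow (regConstSet T U η cube ξ dist ρ) :=
  ⟨0, fun _ hs => hs.1⟩

/-- The optimal regularity constant is `≥ 0`. [cite: Balaban1985Variational, (9)–(10) p.279 (bookkeeping)] -/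
theorem regConst_nonneg (η : ℝ) (cube : Set S) (ξ : ℝ) (dist : S → S → ℝ) (ρ : ℝ) :
    0 ≤ regConst T U η cube ξ dist ρ :=
  Real.sInf_nonneg fun _ hs => hs.1

/-- The admissible majorants form an UPPER set (`ξ > 0`, `ρ ≥ 0`; n05-e's `Reg910Cube.mono`). [cite: Balaban1985Variational, (9)–(10) p.279 (bookkeeping)] -/
theorem mem_regConstSet_of_le {η : ℝ} {cube : Set S} {ξ : ℝ} (hξ : 0 < ξ) {dist : S → S → ℝ} {ρ : ℝ} (hρ : 0 ≤ ρ)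
    {s s' : ℝ} (hs : s ∈ regConstSet T U η cube ξ dist ρ) (h : s ≤ s') : s' ∈ regConstSet T U η cube ξ dist ρ :=
  ⟨hs.1.trans h, hs.2.mono T U hξ h (mul_le_mul_of_nonneg_left h hρ)⟩

/-- ★ **SOUNDNESS**: if `(U, □)` admits a majorant and its optimal regularity constant lies STRICTLY below `C` and below `C₄/ρ`, then `(U, □)` is in print's
class (9)–(10) with constants `(C, C₄)` — some admissible `s < min C (C₄/ρ)` exists (`csInf_lt_iff`) and its gauge serves (`Reg910Cube.mono`).
[cite: Balaban1985Variational, Thm 1 (9)–(10) p.279] -/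
theorem reg910Cube_of_regConst_lt {η : ℝ} {cube : Set S} {ξ : ℝ} (hξ : 0 < ξ) {dist : S → S → ℝ} {ρ : ℝ} (hρ : 0 < ρ)
    (hne : (regConstSet T U η cube ξ dist ρ).Nonempty) {C C₄ : ℝ} (hC : regConst T U η cube ξ dist ρ < C)
    (hC₄ : ρ * regConst T U η cube ξ dist ρ < C₄) : Reg910Cube T U η cube ξ dist C C₄ 1 := by
  have hlt : regConst T U η cube ξ dist ρ < min C (C₄ / ρ) :=
    lt_min hC (by rw [lt_div_iff₀ hρ, mul_comm]; exact hC₄)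
  obtain ⟨s, hs, hsm⟩ := (csInf_lt_iff (regConstSet_bddBelow η cube ξ dist ρ) hne).1 hlt
  refine hs.2.mono T U hξ (hsm.le.trans (min_le_left _ _)) ?_
  calc ρ * s ≤ ρ * (C₄ / ρ) := mul_le_mul_of_nonneg_left (hsm.le.trans (min_le_right _ _)) hρ.le
    _ = C₄ := by field_simp

/-- **COMPLETENESS, WEAK FORM**: a gauge witnessing (9)–(10) at constants `(C, C₄)`, `C ≥ 0`, is an admissible majorant `max C (C₄/ρ)`; so `(U, □)` admits one and
its optimal constant is `≤ max C (C₄/ρ)`. [cite: Balaban1985Variational, Thm 1 (9)–(10) p.279] -/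
theorem regConst_le_of_reg910Cube {η : ℝ} {cube : Set S} {ξ : ℝ} (hξ : 0 < ξ) {dist : S → S → ℝ} {ρ : ℝ} (hρ : 0 < ρ)
    {C C₄ : ℝ} (hC : 0 ≤ C) (h : Reg910Cube T U η cube ξ dist C C₄ 1) :
    (regConstSet T U η cube ξ dist ρ).Nonempty ∧ regConst T U η cube ξ dist ρ ≤ max C (C₄ / ρ) := by
  have hmem : max C (C₄ / ρ) ∈ regConstSet T U η cube ξ dist ρ := by
    refine ⟨hC.trans (le_max_left _ _), h.mono T U hξ (le_max_left _ _) ?_⟩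
    calc C₄ = ρ * (C₄ / ρ) := by field_simp
      _ ≤ ρ * max C (C₄ / ρ) := mul_le_mul_of_nonneg_left (le_max_right _ _) hρ.le
  exact ⟨⟨_, hmem⟩, csInf_le (regConstSet_bddBelow η cube ξ dist ρ) hmem⟩

/-- Endpoint domination of the Hölder weights: `t^β ≤ max 1 t` for `t > 0`, `0 ≤ β ≤ 1` (`Real.rpow` monotone ∕ antitone in the exponent).
[cite: Balaban1985Variational, (9) p.279 («0 ≦ β ≦ β₀ = 1»; bookkeeping)] -/
theorem rpow_le_max_one_self {t β : ℝ} (ht : 0 < t) (hβ : 0 ≤ β) (hβ1 : β ≤ 1) : t ^ β ≤ max 1 t := by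
  rcases le_total 1 t with h | h
  · calc t ^ β ≤ t ^ (1 : ℝ) := Real.rpow_le_rpow_of_exponent_le h hβ1
      _ = t := Real.rpow_one t
      _ ≤ max 1 t := le_max_right _ _
  · calc t ^ β ≤ t ^ (0 : ℝ) := Real.rpow_le_rpow_of_exponent_ge ht h hβ
      _ = 1 := Real.rpow_zero t
      _ ≤ max 1 t := le_max_left _ _

/-- Finitely many reals below `b > 0` lie below some `0 < s < b`. [folklore] -/
private theorem exists_pos_lt_forall_lt {J : Type*} [Finite J] (f : J → ℝ) {b : ℝ} (hb : 0 < b) (hf : ∀ j, f j < b) :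
    ∃ s : ℝ, 0 < s ∧ s < b ∧ ∀ j, f j < s := by
  rcases isEmpty_or_nonempty J with hJ | hJ
  · exact ⟨b / 2, by positivity, by linarith, fun j => isEmptyElim j⟩
  · haveI := Fintype.ofFinite J
    obtain ⟨j₀, -, hj₀⟩ := Finset.exists_max_image Finset.univ f Finset.univ_nonempty
    refine ⟨max (b / 2) ((f j₀ + b) / 2), lt_max_of_lt_left (by positivity), max_lt (by linarith) (by linarith [hf j₀]),
      fun j => lt_max_of_lt_right ?_⟩
    linarith [hj₀ j (Finset.mem_univ j), hf j₀]

/-- ★★ **COMPLETENESS, STRICT FORM, on a FINITE site type** (NODE 00's tori are finite): a gauge witnessing (9)–(10) at constants `(C, C₄)`, `C > 0`, witnesses the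
scaled majorant `s` for some `s < max C (C₄/ρ)` STRICTLY — each of the finitely many members (bonds `(κ, z)`, pairs `(κ, ν, z)`, `(μ, z)`, and pairs of sites
`(z, z′)` with `0 < dist ≤ 1` at the Hölder ENDPOINTS `β = 0, 1`) is strict, and the Hölder member at every `β ∈ [0, 1]` follows from its endpoints
(`rpow_le_max_one_self`); hence the optimal constant is `< max C (C₄/ρ)`.  On the ray `C₄ = ρC` the bound is `C` itself.
[cite: Balaban1985Variational, Thm 1 (9)–(10) p.279] -/
theorem regConst_lt_of_reg910Cube [Finite S] {η : ℝ} {cube : Set S} {ξ : ℝ} (hξ : 0 < ξ) {dist : S → S → ℝ} {ρ : ℝ}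
    (hρ : 0 < ρ) {C C₄ : ℝ} (hC : 0 < C) (h : Reg910Cube T U η cube ξ dist C C₄ 1) :
    (regConstSet T U η cube ξ dist ρ).Nonempty ∧ regConst T U η cube ξ dist ρ < max C (C₄ / ρ) := by
  obtain ⟨u, A, hu, hg, hA, hD, hH, h10, hL⟩ := h
  have hb : 0 < max C (C₄ / ρ) := lt_max_of_lt_left hC
  have hCb : C ≤ max C (C₄ / ρ) := le_max_left _ _
  have hC₄b : C₄ / ρ ≤ max C (C₄ / ρ) := le_max_right _ _
  have e20 : ξ ^ ((2 : ℝ) + 0) = ξ ^ 2 := by rw [add_zero, Real.rpow_two]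
  have e21 : ξ ^ ((2 : ℝ) + 1) = ξ ^ 3 := by
    rw [show ((2 : ℝ) + 1) = ((3 : ℕ) : ℝ) by norm_num, Real.rpow_natCast]
  set G : ι → ι → S → 𝔸 := fun κ ν z => ((η : ℂ)⁻¹) • covD T (fun _ _ => (1 : 𝔸ˣ)) κ (A ν) z with hG_def
  -- the six finite families of scaled member values, each `< max C (C₄ / ρ)`
  have f₁ : ∀ p : ι × cube, ‖A p.1 (p.2 : S)‖ * ξ < max C (C₄ / ρ) := by
    rintro ⟨κ, z, hz⟩
    have h1 : ‖A κ z‖ < C / ξ := by simpa [div_eq_mul_inv] using hA κ z hz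
    exact ((lt_div_iff₀ hξ).1 h1).trans_le hCb
  have f₂ : ∀ p : ι × ι × cube, ‖G p.1 p.2.1 (p.2.2 : S)‖ * ξ ^ 2 < max C (C₄ / ρ) := by
    rintro ⟨κ, ν, z, hz⟩
    have h1 : ‖G κ ν z‖ < C / ξ ^ 2 := by simpa [hG_def, div_eq_mul_inv] using hD κ ν z hz
    exact ((lt_div_iff₀ (pow_pos hξ 2)).1 h1).trans_le hCb
  have f₃ : ∀ p : ι × cube,
      ‖divPη T (fun _ _ => (1 : 𝔸ˣ)) η (curlη T (fun _ _ => (1 : 𝔸ˣ)) η A) p.1 (p.2 : S)‖ * ξ ^ 3 < max C (C₄ / ρ) := by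
    rintro ⟨μ, z, hz⟩
    have h1 : ‖divPη T (fun _ _ => (1 : 𝔸ˣ)) η (curlη T (fun _ _ => (1 : 𝔸ˣ)) η A) μ z‖ < C / ξ ^ 3 := by
      simpa [div_eq_mul_inv] using h10 μ z hz
    exact ((lt_div_iff₀ (pow_pos hξ 3)).1 h1).trans_le hCb
  have f₄ : ∀ p : ι × cube, ‖lapη T (fun _ _ => (1 : 𝔸ˣ)) η (A p.1) (p.2 : S)‖ * ξ ^ 3 < max C (C₄ / ρ) := by
    rintro ⟨κ, z, hz⟩
    have h1 : ‖lapη T (fun _ _ => (1 : 𝔸ˣ)) η (A κ) z‖ < C / ξ ^ 3 := by simpa [div_eq_mul_inv] using hL κ z hz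
    exact ((lt_div_iff₀ (pow_pos hξ 3)).1 h1).trans_le hCb
  have f₅ : ∀ p : {q : ι × ι × cube × cube // 0 < dist (q.2.2.1 : S) q.2.2.2 ∧ dist (q.2.2.1 : S) q.2.2.2 ≤ 1},
      ‖G p.1.1 p.1.2.1 (p.1.2.2.2 : S) - G p.1.1 p.1.2.1 (p.1.2.2.1 : S)‖ * ξ ^ 2 / ρ < max C (C₄ / ρ) := by
    rintro ⟨⟨κ, ν, ⟨z, hz⟩, ⟨z', hz'⟩⟩, hd, hd1⟩
    have h1 : ‖G κ ν z' - G κ ν z‖ < C₄ / ξ ^ 2 := by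
      have := hH 0 le_rfl zero_le_one κ ν z hz z' hz' hd hd1
      rw [e20, Real.rpow_zero, mul_one, ← div_eq_mul_inv] at this
      simpa [hG_def] using this
    have h2 : ‖G κ ν z' - G κ ν z‖ * ξ ^ 2 < C₄ := (lt_div_iff₀ (pow_pos hξ 2)).1 h1
    exact (div_lt_div_of_pos_right h2 hρ).trans_le hC₄b
  have f₆ : ∀ p : {q : ι × ι × cube × cube // 0 < dist (q.2.2.1 : S) q.2.2.2 ∧ dist (q.2.2.1 : S) q.2.2.2 ≤ 1},
      ‖G p.1.1 p.1.2.1 (p.1.2.2.2 : S) - G p.1.1 p.1.2.1 (p.1.2.2.1 : S)‖ * ξ ^ 3 / dist (p.1.2.2.1 : S) p.1.2.2.2 / ρ <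
        max C (C₄ / ρ) := by
    rintro ⟨⟨κ, ν, ⟨z, hz⟩, ⟨z', hz'⟩⟩, hd, hd1⟩
    have h1 : ‖G κ ν z' - G κ ν z‖ < C₄ * dist z z' / ξ ^ 3 := by
      have := hH 1 zero_le_one le_rfl κ ν z hz z' hz' hd hd1
      rw [e21, Real.rpow_one] at this
      have e : C₄ * (ξ ^ 3)⁻¹ * dist z z' = C₄ * dist z z' / ξ ^ 3 := by
        simp only [div_eq_mul_inv]; ring
      rw [e] at this
      simpa [hG_def] using this
    have h2 : ‖G κ ν z' - G κ ν z‖ * ξ ^ 3 < C₄ * dist z z' := (lt_div_iff₀ (pow_pos hξ 3)).1 h1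
    have h3 : ‖G κ ν z' - G κ ν z‖ * ξ ^ 3 / dist z z' < C₄ := (div_lt_iff₀ hd).2 h2
    exact (div_lt_div_of_pos_right h3 hρ).trans_le hC₄b
  obtain ⟨s₁, h₁0, h₁b, h₁⟩ := exists_pos_lt_forall_lt _ hb f₁
  obtain ⟨s₂, -, h₂b, h₂⟩ := exists_pos_lt_forall_lt _ hb f₂
  obtain ⟨s₃, -, h₃b, h₃⟩ := exists_pos_lt_forall_lt _ hb f₃
  obtain ⟨s₄, -, h₄b, h₄⟩ := exists_pos_lt_forall_lt _ hb f₄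
  obtain ⟨s₅, -, h₅b, h₅⟩ := exists_pos_lt_forall_lt _ hb f₅
  obtain ⟨s₆, -, h₆b, h₆⟩ := exists_pos_lt_forall_lt _ hb f₆
  set s : ℝ := max s₁ (max s₂ (max s₃ (max s₄ (max s₅ s₆)))) with hs_def
  have hs0 : 0 < s := lt_max_of_lt_left h₁0
  have hsb : s < max C (C₄ / ρ) := by simp only [hs_def, max_lt_iff]; exact ⟨h₁b, h₂b, h₃b, h₄b, h₅b, h₆b⟩
  have l₁ : s₁ ≤ s := by simp [hs_def]
  have l₂ : s₂ ≤ s := by simp [hs_def]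
  have l₃ : s₃ ≤ s := by simp [hs_def]
  have l₄ : s₄ ≤ s := by simp [hs_def]
  have l₅ : s₅ ≤ s := by simp [hs_def]
  have l₆ : s₆ ≤ s := by simp [hs_def]
  have hmem : s ∈ regConstSet T U η cube ξ dist ρ := by
    refine ⟨hs0.le, u, A, hu, hg, fun κ z hz => ?_, fun κ ν z hz => ?_, fun β hβ hβ1 κ ν z hz z' hz' hd hd1 => ?_,
      fun μ z hz => ?_, fun κ z hz => ?_⟩
    · have b1 : ‖A κ z‖ * ξ < s := (show ‖A κ z‖ * ξ < s₁ from h₁ (κ, ⟨z, hz⟩)).trans_le l₁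
      rw [← div_eq_mul_inv, lt_div_iff₀ hξ]
      exact b1
    · have b1 : ‖G κ ν z‖ * ξ ^ 2 < s := (show ‖G κ ν z‖ * ξ ^ 2 < s₂ from h₂ (κ, ν, ⟨z, hz⟩)).trans_le l₂
      rw [← div_eq_mul_inv, lt_div_iff₀ (pow_pos hξ 2)]
      exact b1
    · -- the Hölder member, by endpoint domination
      have hdβ : 0 < dist z z' ^ β := Real.rpow_pos_of_pos hd β
      have w₀ : ‖G κ ν z' - G κ ν z‖ * ξ ^ 2 / ρ < s :=
        (show ‖G κ ν z' - G κ ν z‖ * ξ ^ 2 / ρ < s₅ from h₅ ⟨(κ, ν, ⟨z, hz⟩, ⟨z', hz'⟩), hd, hd1⟩).trans_le l₅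
      have w₁ : ‖G κ ν z' - G κ ν z‖ * ξ ^ 3 / dist z z' / ρ < s :=
        (show ‖G κ ν z' - G κ ν z‖ * ξ ^ 3 / dist z z' / ρ < s₆ from
          h₆ ⟨(κ, ν, ⟨z, hz⟩, ⟨z', hz'⟩), hd, hd1⟩).trans_le l₆
      have w₀' : ‖G κ ν z' - G κ ν z‖ * ξ ^ 2 < ρ * s := by
        have := (div_lt_iff₀ hρ).1 w₀; linarith [mul_comm s ρ]
      have w₁' : ‖G κ ν z' - G κ ν z‖ * ξ ^ 3 / dist z z' < ρ * s := by
        have := (div_lt_iff₀ hρ).1 w₁; linarith [mul_comm s ρ]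
      have hmax : ‖G κ ν z' - G κ ν z‖ * ξ ^ 2 * max 1 (ξ / dist z z') < ρ * s := by
        rcases le_total 1 (ξ / dist z z') with h1 | h1
        · rw [max_eq_right h1]
          have e : ‖G κ ν z' - G κ ν z‖ * ξ ^ 2 * (ξ / dist z z') = ‖G κ ν z' - G κ ν z‖ * ξ ^ 3 / dist z z' := by
            simp only [div_eq_mul_inv]; ring
          rw [e]; exact w₁'
        · rw [max_eq_left h1, mul_one]; exact w₀'
      have hξβ : ξ ^ β ≤ max 1 (ξ / dist z z') * dist z z' ^ β := by
        have := rpow_le_max_one_self (div_pos hξ hd) hβ hβ1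
        rw [Real.div_rpow hξ.le hd.le] at this
        exact (div_le_iff₀ hdβ).1 this
      have key : ‖G κ ν z' - G κ ν z‖ * ξ ^ (2 + β) < ρ * s * dist z z' ^ β :=
        calc ‖G κ ν z' - G κ ν z‖ * ξ ^ (2 + β) = ‖G κ ν z' - G κ ν z‖ * ξ ^ 2 * ξ ^ β := by
              rw [Real.rpow_add hξ, Real.rpow_two]; ring
          _ ≤ ‖G κ ν z' - G κ ν z‖ * ξ ^ 2 * (max 1 (ξ / dist z z') * dist z z' ^ β) :=
              mul_le_mul_of_nonneg_left hξβ (by positivity)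
          _ = ‖G κ ν z' - G κ ν z‖ * ξ ^ 2 * max 1 (ξ / dist z z') * dist z z' ^ β := by ring
          _ < ρ * s * dist z z' ^ β := mul_lt_mul_of_pos_right hmax hdβ
      have e : ρ * s * (ξ ^ (2 + β))⁻¹ * dist z z' ^ β = ρ * s * dist z z' ^ β / ξ ^ (2 + β) := by
        simp only [div_eq_mul_inv]; ring
      show ‖G κ ν z' - G κ ν z‖ < ρ * s * (ξ ^ (2 + β))⁻¹ * dist z z' ^ β
      rw [e, lt_div_iff₀ (Real.rpow_pos_of_pos hξ _)]
      exact key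
    · have b1 : ‖divPη T (fun _ _ => (1 : 𝔸ˣ)) η (curlη T (fun _ _ => (1 : 𝔸ˣ)) η A) μ z‖ * ξ ^ 3 < s :=
        (show _ < s₃ from h₃ (μ, ⟨z, hz⟩)).trans_le l₃
      rw [← div_eq_mul_inv, lt_div_iff₀ (pow_pos hξ 3)]
      exact b1
    · have b1 : ‖lapη T (fun _ _ => (1 : 𝔸ˣ)) η (A κ) z‖ * ξ ^ 3 < s := (show _ < s₄ from h₄ (κ, ⟨z, hz⟩)).trans_le l₄
      rw [← div_eq_mul_inv, lt_div_iff₀ (pow_pos hξ 3)]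
      exact b1
  exact ⟨⟨s, hmem⟩, (csInf_le (regConstSet_bddBelow η cube ξ dist ρ) hmem).trans_lt hsb⟩

/-- **NON-VACUITY**: the trivial configuration `U ≡ 1` admits every majorant `s > 0` (`u = 1`, `A = 0`; n05-e's `reg910Cube_one`), so it is admissible and its
optimal regularity constant is `0`. [cite: Balaban1985Variational, (9)–(10) p.279; Balaban1985RegularSpaces, p.98 («the configuration … identically equal to 1
satisfies, of course, all possible regularity conditions»)] -/
theorem regConst_one [NormOneClass 𝔸] (η : ℝ) (cube : Set S) {ξ : ℝ} (hξ : 0 < ξ) (dist : S → S → ℝ) {ρ : ℝ} (hρ : 0 < ρ) :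
    (regConstSet T (fun _ _ => (1 : 𝔸ˣ)) η cube ξ dist ρ).Nonempty ∧ regConst T (fun _ _ => (1 : 𝔸ˣ)) η cube ξ dist ρ = 0 := by
  have hmem : ∀ s : ℝ, 0 < s → s ∈ regConstSet T (fun _ _ => (1 : 𝔸ˣ)) η cube ξ dist ρ :=
    fun s hs => ⟨hs.le, B11Reg910Classes.reg910Cube_one T η cube hξ dist hs (mul_pos hρ hs) 1⟩
  refine ⟨⟨1, hmem 1 one_pos⟩, le_antisymm ?_ (regConst_nonneg η cube ξ dist ρ)⟩
  by_contra hle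
  have hlt : 0 < regConst T (fun _ _ => (1 : 𝔸ˣ)) η cube ξ dist ρ := not_le.mp hle
  have h := csInf_le (regConstSet_bddBelow (T := T) (U := fun _ _ => (1 : 𝔸ˣ)) η cube ξ dist ρ) (hmem _ (half_pos hlt))
  exact absurd h (not_le.mpr (half_lt_self hlt))

/-- **DEGENERATE VALUE, PROVED (ref-G READ37 (w6))**: on the EMPTY site set every member of (9)–(10) is vacuous — EVERY configuration is in the class at EVERY
pair of constants (`u := 1`, `A := 0`); so at an empty carrier the optimal regularity constant is `0` and says nothing about `U`.  A count line in (9)–(10)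
currency must read its cubes from print (non-empty: «□ ⊂ B_j(Λ_j) ∪ B_{j+1}(Λ_{j+1})» of size `2MLʲη`). [cite: Balaban1985Variational, (9)–(10) p.279 (bookkeeping)] -/
theorem reg910Cube_empty (η : ℝ) (ξ : ℝ) (dist : S → S → ℝ) (C C₄ β₀ : ℝ) : Reg910Cube T U η (∅ : Set S) ξ dist C C₄ β₀ :=
  ⟨fun _ => 1, fun _ _ => 0, by simp, by simp, by simp, by simp, by simp, by simp, by simp⟩

/-- At an empty site set: admissible, optimal constant `0` — for EVERY `U` (the degenerate value, (w6)). [cite: Balaban1985Variational, (9)–(10) p.279 (bookkeeping)] -/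
theorem regConst_empty (η : ℝ) (ξ : ℝ) (dist : S → S → ℝ) (ρ : ℝ) :
    (regConstSet T U η (∅ : Set S) ξ dist ρ).Nonempty ∧ regConst T U η (∅ : Set S) ξ dist ρ = 0 :=
  have h0 : (0 : ℝ) ∈ regConstSet T U η (∅ : Set S) ξ dist ρ := ⟨le_rfl, reg910Cube_empty η ξ dist 0 (ρ * 0) 1⟩
  ⟨⟨0, h0⟩, le_antisymm (csInf_le (regConstSet_bddBelow η ∅ ξ dist ρ) h0) (regConst_nonneg η ∅ ξ dist ρ)⟩

end Generic

/-! ## §2. The pin at NODE 00's objects -/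

section Record

variable (F : T4Family) (N : ℕ) [NeZero N]

/-- **THE CUBE CLASS OF A LEVEL AS DATA**: abstract cubes `Q`, each READ as a set of sites of the finest torus of the `K`-th approximation (`carrier`), with its
scale index `j = scale q` (`ξ = Lʲη`) and size parameter `M = sizeM q` (size `2MLʲη`), and the η-scale lattice distance `dist` entering the Hölder member —
n07-a's abstract `RegCarrierT.Cube ∕ scale ∕ sizeM` together with g3's geometry slot `RegGeomT`.  DATA, no law (print's class: «□ ⊂ B_j(Λ_j) ∪ B_{j+1}(Λ_{j+1})»,
p. 279; reading D-n07a-4). [cite: Balaban1985Variational, p.279 («We consider all cubes □ satisfying the above conditions»)] -/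
structure RegCubesT (K : ℕ) where
  /-- the abstract cubes -/
  Q : Type
  /-- the cube `□` as a set of sites of the finest torus -/
  carrier : Q → Set (Site (F.P K) 0)
  /-- its scale index `j` (`ξ = Lʲη`) -/
  scale : Q → ℕ
  /-- its size parameter `M` (size `2MLʲη`) -/
  sizeM : Q → ℝ
  /-- the η-scale lattice distance entering the Hölder member of (9) -/
  dist : Site (F.P K) 0 → Site (F.P K) 0 → ℝ

/-- `ξ = Lʲη_k > 0` on NODE 00's tori (`1 < L`, `η_k = L^{−k}`). [cite: Balaban1985Variational, Sect. A p.280 (bookkeeping: «η = L^{−k}»)] -/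
theorem scaleLen_record_pos (K k j : ℕ) : 0 < scaleLen (F.L : ℝ) ((F.P K).eta k) j :=
  LatticeNorms.scaleLen_pos (by exact_mod_cast lt_trans zero_lt_one F.hL.2) (pow_pos (inv_pos.mpr (Nat.cast_pos.mpr (F.P K).L_pos)) k) j

/-- **THE OPTIMAL REGULARITY CONSTANT of `(U, □)` at level `k`** on NODE 00's torus of record: §1's `regConst` for the `SU(N)` configuration `U` read in `M_N(ℂ)ˣ`
(`toPV`), structure maps the unit translations `shiftEquiv`, `η := η_k`, the site set `g.carrier q`, scale `ξ := L^{scale q}η_k`, distance `g.dist`, ratio `ρ`.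
[cite: Balaban1985Variational, Thm 1 (9)–(10) p.279] -/
def regConstT (K k : ℕ) (ρ : ℝ) (g : RegCubesT F K) (U : GaugeField (F.P K) 0 (SU N)) (q : g.Q) : ℝ :=
  regConst (fun μ => (LatticeFieldCalculus.shiftEquiv μ : Equiv.Perm (Site (F.P K) 0))) (toPV U) ((F.P K).eta k) (g.carrier q)
    (scaleLen (F.L : ℝ) ((F.P K).eta k) (g.scale q)) g.dist ρ

/-- **«GAUGED» AT THE PIN**: `(U, □)` ADMITS a majorant — some gauge `u` of unitary type on `□` with `Uᵘ = e^{iηA}` and `A` obeying the scaled bounds for some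
`s ≥ 0` (§1's `regConstSet` non-empty).  An object-level predicate: no free data. [cite: Balaban1985Variational, Thm 1 (9)–(10) p.279 («there exists a gauge
transformation u …»)] -/
def GaugedT (K k : ℕ) (ρ : ℝ) (g : RegCubesT F K) (U : GaugeField (F.P K) 0 (SU N)) (q : g.Q) : Prop :=
  (regConstSet (fun μ => (LatticeFieldCalculus.shiftEquiv μ : Equiv.Perm (Site (F.P K) 0))) (toPV U) ((F.P K).eta k) (g.carrier q)
    (scaleLen (F.L : ℝ) ((F.P K).eta k) (g.scale q)) g.dist ρ).Nonempty

/-- ★ **THE PIN of the regularity datum at level `k`, ratio `ρ`, cube class `g`**: n07-a's `RegCarrierT F N K` with `Cube := g.Q`, `scale`, `sizeM` from `g`,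
`Gauged := GaugedT`, and the five numbers READ OFF THE OPTIMAL REGULARITY CONSTANT in the literal shapes of `B11.Regularity`'s thresholds:
`normA := regConst·ξ⁻¹^1`, `normGradA := regConst·ξ⁻¹^2`, `holderA β := ρ·regConst·(ξ⁻¹)^{2+β}`, `normLapA := regConst·ξ⁻¹^3`, `ξ := L^{scale q}η_k`.
GAUGE-INVARIANT (no gauge chosen); SOUND at all thresholds, EXACT on the ray `B₄ = ρB₃` (below). [cite: Balaban1985Variational, Thm 1 (9)–(10) p.279] -/
def regPinT (K k : ℕ) (ρ : ℝ) (g : RegCubesT F K) : RegCarrierT F N K where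
  Cube := g.Q
  scale := g.scale
  sizeM := g.sizeM
  Gauged := fun U q => GaugedT F N K k ρ g U q
  normA := fun U q => regConstT F N K k ρ g U q * (scaleLen (F.L : ℝ) ((F.P K).eta k) (g.scale q))⁻¹ ^ 1
  normGradA := fun U q => regConstT F N K k ρ g U q * (scaleLen (F.L : ℝ) ((F.P K).eta k) (g.scale q))⁻¹ ^ 2
  holderA := fun U q β => ρ * regConstT F N K k ρ g U q * ((scaleLen (F.L : ℝ) ((F.P K).eta k) (g.scale q))⁻¹) ^ (2 + β)
  normLapA := fun U q => regConstT F N K k ρ g U q * (scaleLen (F.L : ℝ) ((F.P K).eta k) (g.scale q))⁻¹ ^ 3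

variable {F N}

/-- The pin's «gauged», unfolded: `(U, □)` admits a majorant `s ≥ 0` of print's scaled members in some gauge (n05-e's `Reg910T` at `(s, ρs)`, `β₀ = 1`).
[cite: Balaban1985Variational, Thm 1 (9)–(10) p.279 (bookkeeping)] -/
theorem gaugedT_iff {K k : ℕ} {ρ : ℝ} {g : RegCubesT F K} {U : GaugeField (F.P K) 0 (SU N)} {q : g.Q} :
    GaugedT F N K k ρ g U q ↔ ∃ s : ℝ, 0 ≤ s ∧ Reg910T F N K k U (g.carrier q) (g.scale q) g.dist s (ρ * s) 1 :=
  ⟨fun ⟨s, hs⟩ => ⟨s, hs.1, hs.2⟩, fun ⟨s, h0, h⟩ => ⟨s, h0, h⟩⟩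

/-- **THE TYPED CLAUSE AT THE PIN, UNFOLDED**: `B11.Regularity` of Theorem 1 (read through n07-a's `varProblemT`) at `(U, □)` with thresholds `(B₃, B₄, ε₁)` holds at
the pin iff `(U, □)` is gauged and its optimal regularity constant lies below `B₃Mε₁` and below `B₄Mε₁/ρ` — `varProblemT`'s `L^{scale □}·η` is `scaleLen F.L η
(scale □)` by `rfl` and the positive factors `ξ⁻¹ⁿ` cancel (the Hölder clause for all `β ∈ [0, 1]` is one inequality). [cite: Balaban1985Variational, Thm 1 (9)–(10) p.279] -/
theorem regularity_regPinT_iff {K k : ℕ} {ρ : ℝ} {g : RegCubesT F K} {B₃ B₄ ε₁ : ℝ} {U : GaugeField (F.P K) 0 (SU N)} {q : g.Q} :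
    B11.Regularity (varProblemT F N K k (regPinT F N K k ρ g)) B₃ B₄ ε₁ U q ↔
      GaugedT F N K k ρ g U q ∧ regConstT F N K k ρ g U q < B₃ * g.sizeM q * ε₁ ∧
        ρ * regConstT F N K k ρ g U q < B₄ * g.sizeM q * ε₁ := by
  have hξ : 0 < (scaleLen (F.L : ℝ) ((F.P K).eta k) (g.scale q))⁻¹ := inv_pos.2 (scaleLen_record_pos F K k _)
  constructor
  · rintro ⟨hG, hA, -, hH, -⟩
    refine ⟨hG, ?_, ?_⟩
    · have hA' : regConstT F N K k ρ g U q * (scaleLen (F.L : ℝ) ((F.P K).eta k) (g.scale q))⁻¹ ^ 1 <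
          B₃ * g.sizeM q * ε₁ * (scaleLen (F.L : ℝ) ((F.P K).eta k) (g.scale q))⁻¹ ^ 1 := hA
      exact lt_of_mul_lt_mul_right hA' (pow_pos hξ 1).le
    · have hH' : ρ * regConstT F N K k ρ g U q * (scaleLen (F.L : ℝ) ((F.P K).eta k) (g.scale q))⁻¹ ^ ((2 : ℝ) + 0) <
          B₄ * g.sizeM q * ε₁ * (scaleLen (F.L : ℝ) ((F.P K).eta k) (g.scale q))⁻¹ ^ ((2 : ℝ) + 0) := hH 0 le_rfl zero_le_one
      exact lt_of_mul_lt_mul_right hH' (Real.rpow_pos_of_pos hξ _).le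
  · rintro ⟨hG, h₃, h₄⟩
    refine ⟨hG, ?_, ?_, fun β _ _ => ?_, ?_⟩
    · show regConstT F N K k ρ g U q * (scaleLen (F.L : ℝ) ((F.P K).eta k) (g.scale q))⁻¹ ^ 1 <
        B₃ * g.sizeM q * ε₁ * (scaleLen (F.L : ℝ) ((F.P K).eta k) (g.scale q))⁻¹ ^ 1
      exact mul_lt_mul_of_pos_right h₃ (pow_pos hξ 1)
    · show regConstT F N K k ρ g U q * (scaleLen (F.L : ℝ) ((F.P K).eta k) (g.scale q))⁻¹ ^ 2 <
        B₃ * g.sizeM q * ε₁ * (scaleLen (F.L : ℝ) ((F.P K).eta k) (g.scale q))⁻¹ ^ 2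
      exact mul_lt_mul_of_pos_right h₃ (pow_pos hξ 2)
    · show ρ * regConstT F N K k ρ g U q * (scaleLen (F.L : ℝ) ((F.P K).eta k) (g.scale q))⁻¹ ^ (2 + β) <
        B₄ * g.sizeM q * ε₁ * (scaleLen (F.L : ℝ) ((F.P K).eta k) (g.scale q))⁻¹ ^ (2 + β)
      exact mul_lt_mul_of_pos_right h₄ (Real.rpow_pos_of_pos hξ _)
    · show regConstT F N K k ρ g U q * (scaleLen (F.L : ℝ) ((F.P K).eta k) (g.scale q))⁻¹ ^ 3 <
        B₃ * g.sizeM q * ε₁ * (scaleLen (F.L : ℝ) ((F.P K).eta k) (g.scale q))⁻¹ ^ 3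
      exact mul_lt_mul_of_pos_right h₃ (pow_pos hξ 3)

/-- ★ **SOUNDNESS FACE — ALL THRESHOLDS**: the typed regularity clause of Theorem 1 AT THE PIN, at `(U, □)` with thresholds `(B₃, B₄, ε₁)`, GIVES print's (9)–(10)
on `□` in the ∃u-form `Reg910T`, constants `C := B₃Mε₁`, `C₄ := B₄Mε₁`, `β₀ := 1`, `ξ := Lʲη` (§1's `reg910Cube_of_regConst_lt`; `ρ > 0`).  No law is displayed:
at the pin soundness is a theorem. [cite: Balaban1985Variational, Thm 1 (9)–(10) p.279] -/
theorem reg910T_of_regularity_regPinT {K k : ℕ} {ρ : ℝ} (hρ : 0 < ρ) {g : RegCubesT F K} {B₃ B₄ ε₁ : ℝ} {U : GaugeField (F.P K) 0 (SU N)}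
    {q : g.Q} (hr : B11.Regularity (varProblemT F N K k (regPinT F N K k ρ g)) B₃ B₄ ε₁ U q) :
    Reg910T F N K k U (g.carrier q) (g.scale q) g.dist (B₃ * g.sizeM q * ε₁) (B₄ * g.sizeM q * ε₁) 1 := by
  obtain ⟨hG, h₃, h₄⟩ := regularity_regPinT_iff.1 hr
  exact reg910Cube_of_regConst_lt (scaleLen_record_pos F K k _) hρ hG h₃ h₄

/-- ★ **THE CONSUMED CURRENCY**: the typed clause at the pin gives [Balaban1985BackgroundPropagators] (3.35)–(3.36) on `□` with `O(1)Mα₀ := B₃Mε₁` — n05-e's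
`Reg910Cube.reg336Cube` by name. [cite: Balaban1985BackgroundPropagators, (3.35)–(3.36) p.396; Balaban1985Variational, Thm 1 (9)–(10) p.279] -/
theorem reg336Cube_of_regularity_regPinT {K k : ℕ} {ρ : ℝ} (hρ : 0 < ρ) {g : RegCubesT F K} {B₃ B₄ ε₁ : ℝ} {U : GaugeField (F.P K) 0 (SU N)}
    {q : g.Q} (hr : B11.Regularity (varProblemT F N K k (regPinT F N K k ρ g)) B₃ B₄ ε₁ U q) :
    Reg336Cube (fun μ => (LatticeFieldCalculus.shiftEquiv μ : Equiv.Perm (Site (F.P K) 0))) (toPV U) ((F.P K).eta k)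
      (g.carrier q) (scaleLen (F.L : ℝ) ((F.P K).eta k) (g.scale q)) (B₃ * g.sizeM q * ε₁) :=
  (reg910T_of_regularity_regPinT hρ hr).reg336Cube _ _

/-- **COMPLETENESS, WEAK FORM, ALL THRESHOLDS**: print's sentence at constants `(B₃Mε₁, B₄Mε₁)` with `0 ≤ B₃Mε₁` makes `(U, □)` gauged at the pin with optimal
constant `≤ max (B₃Mε₁) (B₄Mε₁/ρ)` — so the typed clause holds at the pin at every STRICTLY LARGER pair of thresholds on the ray through that point (g3's design
fact: off the ray, no more). [cite: Balaban1985Variational, Thm 1 (9)–(10) p.279] -/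
theorem gaugedT_and_regConstT_le_of_reg910T {K k : ℕ} {ρ : ℝ} (hρ : 0 < ρ) {g : RegCubesT F K} {C C₄ : ℝ} (hC : 0 ≤ C)
    {U : GaugeField (F.P K) 0 (SU N)} {q : g.Q} (h : Reg910T F N K k U (g.carrier q) (g.scale q) g.dist C C₄ 1) :
    GaugedT F N K k ρ g U q ∧ regConstT F N K k ρ g U q ≤ max C (C₄ / ρ) :=
  regConst_le_of_reg910Cube (scaleLen_record_pos F K k _) hρ hC h

/-- ★★ **EXACTNESS ON THE RAY, completeness direction**: print's (9)–(10) on `□` at constants `(B₃Mε₁, B₄Mε₁)` with `B₄ = ρB₃` and `0 < B₃Mε₁` GIVE the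
typed clause at the pin with thresholds `(B₃, B₄, ε₁)` — §1's STRICT completeness on the finite torus `Site (F.P K) 0`. [cite: Balaban1985Variational, Thm 1 (9)–(10) p.279] -/
theorem regularity_regPinT_of_reg910T {K k : ℕ} {ρ : ℝ} (hρ : 0 < ρ) {g : RegCubesT F K} {B₃ B₄ ε₁ : ℝ} (hray : B₄ = ρ * B₃)
    {U : GaugeField (F.P K) 0 (SU N)} {q : g.Q} (hM : 0 < B₃ * g.sizeM q * ε₁)
    (h : Reg910T F N K k U (g.carrier q) (g.scale q) g.dist (B₃ * g.sizeM q * ε₁) (B₄ * g.sizeM q * ε₁) 1) :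
    B11.Regularity (varProblemT F N K k (regPinT F N K k ρ g)) B₃ B₄ ε₁ U q := by
  subst hray
  obtain ⟨hG, hlt⟩ := regConst_lt_of_reg910Cube (ρ := ρ) (scaleLen_record_pos F K k (g.scale q)) hρ hM h
  have hmax : max (B₃ * g.sizeM q * ε₁) (ρ * B₃ * g.sizeM q * ε₁ / ρ) = B₃ * g.sizeM q * ε₁ := by
    rw [show ρ * B₃ * g.sizeM q * ε₁ = ρ * (B₃ * g.sizeM q * ε₁) by ring, mul_div_cancel_left₀ _ hρ.ne', max_self]
  rw [hmax] at hlt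
  refine regularity_regPinT_iff.2 ⟨hG, hlt, ?_⟩
  calc ρ * regConstT F N K k ρ g U q < ρ * (B₃ * g.sizeM q * ε₁) := mul_lt_mul_of_pos_left hlt hρ
    _ = ρ * B₃ * g.sizeM q * ε₁ := by ring

/-- ★★ **THE PIN IS EXACT ON THE RAY `B₄ = ρB₃`**: for thresholds `(B₃, B₄, ε₁)` with `B₄ = ρB₃` and `0 < B₃Mε₁`, the TYPED regularity clause of Theorem 1 at
the pin at `(U, □)` IS print's (9)–(10) on `□` in the ∃u-form with constants `(B₃Mε₁, B₄Mε₁)`.  The object-level pin of F8 in the one form that needs no gauge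
map. [cite: Balaban1985Variational, Thm 1 (9)–(10) p.279] -/
theorem regularity_regPinT_iff_reg910T {K k : ℕ} {ρ : ℝ} (hρ : 0 < ρ) {g : RegCubesT F K} {B₃ B₄ ε₁ : ℝ} (hray : B₄ = ρ * B₃)
    {U : GaugeField (F.P K) 0 (SU N)} {q : g.Q} (hM : 0 < B₃ * g.sizeM q * ε₁) :
    B11.Regularity (varProblemT F N K k (regPinT F N K k ρ g)) B₃ B₄ ε₁ U q ↔
      Reg910T F N K k U (g.carrier q) (g.scale q) g.dist (B₃ * g.sizeM q * ε₁) (B₄ * g.sizeM q * ε₁) 1 :=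
  ⟨fun hr => reg910T_of_regularity_regPinT hρ hr, regularity_regPinT_of_reg910T hρ hray hM⟩

/-- **THE THIRD CONJUNCT OF `Thm1At` AT THE PIN IS PRINT's SENTENCE** (constants on the ray `B₄ = ρB₃`, cubes with `sizeM > 0`): «for every minimal configuration
`U` of (5) over `𝔘_k(B₃ε₁) ∩ 𝔅_k(V)` and every cube with `M ≤ M₀`, (9)–(10) on `□` in the ∃u-form». [cite: Balaban1985Variational, Thm 1 p.279] -/
theorem reg910_regPinT_iff {K k : ℕ} {ρ : ℝ} (hρ : 0 < ρ) {g : RegCubesT F K} {B₃ B₄ ε₁ M₀ : ℝ} (hray : B₄ = ρ * B₃) (hB₃ : 0 < B₃)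
    (hε₁ : 0 < ε₁) (hMq : ∀ q : g.Q, 0 < g.sizeM q) (V : GaugeField (F.P K) k (SU N)) :
    B11Thm1.Reg910 (varProblemT F N K k (regPinT F N K k ρ g)) B₃ B₄ ε₁ M₀ V ↔
      ∀ U : GaugeField (F.P K) 0 (SU N), IsBackground (avOfRecord F N K) {U | InUkClassB11 F N K k (B₃ * ε₁) U} k V U →
        ∀ q : g.Q, g.sizeM q ≤ M₀ →
          Reg910T F N K k U (g.carrier q) (g.scale q) g.dist (B₃ * g.sizeM q * ε₁) (B₄ * g.sizeM q * ε₁) 1 :=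
  forall_congr' fun _ => forall_congr' fun _ => forall_congr' fun q => forall_congr' fun _ =>
    regularity_regPinT_iff_reg910T hρ hray (mul_pos (mul_pos hB₃ (hMq q)) hε₁)

variable (F N) in
/-- **CONSTANTS MOVED ONTO THE RAY**: Theorem 1's block of constants with `B₄` replaced by `ρB₃` (`ρ > 0`; positivity kept). [cite: Balaban1985Variational, Thm 1
p.279 («positive constants a₀, a₁, B₃, B₄(β₀), M(ε₁)»; bookkeeping)] -/
def constsOnRay (C : B11Thm1.Consts) (ρ : ℝ) (hρ : 0 < ρ) : B11Thm1.Consts :=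
  { C with B₄ := ρ * C.B₃, B₄_pos := mul_pos hρ C.B₃_pos }

/-- **OFF-RAY NORMALISATION**: typed Theorem 1 at the pin with ANY constants `C` implies typed Theorem 1 at the pin with the constants moved onto the ray
(`B₄ := ρB₃`): the typed clause at the pin bounds `regConst < B₃Mε₁`, whence `ρ·regConst < ρB₃Mε₁`; (8) and uniqueness do not read `B₄`.
[cite: Balaban1985Variational, Thm 1 p.279 (bookkeeping)] -/
theorem thm1At_regPinT_onRay {K k : ℕ} {ρ : ℝ} (hρ : 0 < ρ) {g : RegCubesT F K} {C : B11Thm1.Consts}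
    (h : Thm1At C (varProblemT F N K k (regPinT F N K k ρ g))) : Thm1At (constsOnRay C ρ hρ) (varProblemT F N K k (regPinT F N K k ρ g)) := by
  intro ε₁ h₁ h₂ V hV
  obtain ⟨h8, h6, h910⟩ := h ε₁ h₁ h₂ V hV
  refine ⟨h8, h6, fun U hU q hq => ?_⟩
  obtain ⟨hG, h₃, -⟩ := regularity_regPinT_iff.1 (h910 U hU q hq)
  refine regularity_regPinT_iff.2 ⟨hG, h₃, ?_⟩
  show ρ * regConstT F N K k ρ g U q < ρ * C.B₃ * g.sizeM q * ε₁
  calc ρ * regConstT F N K k ρ g U q < ρ * (C.B₃ * g.sizeM q * ε₁) := mul_lt_mul_of_pos_left h₃ hρ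
    _ = ρ * C.B₃ * g.sizeM q * ε₁ := by ring

/-- ★★ **THEOREM 1 AT THE PIN, constants on the ray `C.B₄ = ρC.B₃`, cubes with `sizeM > 0`**: the typed `Thm1At C` at the pinned problem IS «for every
`0 < ε₁ ≤ a₁` and `V` with (7): (8) ∧ uniqueness in (6) ∧ print's (9)–(10) for every minimal `U` and cube with `M ≤ M(ε₁)`» — the first two conjuncts by name
(n07-a's `Exists8`, `Unique6`: they read objects, not `R` — `B11Thm1CarrierT.exists8_iff`, `unique6_iff`), the third print's ∃u-sentence.
[cite: Balaban1985Variational, Thm 1 pp.278–279] -/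
theorem thm1At_regPinT_iff {K k : ℕ} {ρ : ℝ} (hρ : 0 < ρ) {g : RegCubesT F K} (C : B11Thm1.Consts) (hray : C.B₄ = ρ * C.B₃)
    (hMq : ∀ q : g.Q, 0 < g.sizeM q) :
    Thm1At C (varProblemT F N K k (regPinT F N K k ρ g)) ↔
      ∀ ε₁ : ℝ, 0 < ε₁ → ε₁ ≤ C.a₁ → ∀ V : GaugeField (F.P K) k (SU N), PlaqSmall ε₁ V →
        Exists8 (varProblemT F N K k (regPinT F N K k ρ g)) C.B₃ ε₁ V ∧
        Unique6 (varProblemT F N K k (regPinT F N K k ρ g)) C.a₀ C.B₃ ε₁ V ∧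
        ∀ U : GaugeField (F.P K) 0 (SU N), IsBackground (avOfRecord F N K) {U | InUkClassB11 F N K k (C.B₃ * ε₁) U} k V U →
          ∀ q : g.Q, g.sizeM q ≤ C.Mfun ε₁ →
            Reg910T F N K k U (g.carrier q) (g.scale q) g.dist (C.B₃ * g.sizeM q * ε₁) (C.B₄ * g.sizeM q * ε₁) 1 :=
  forall_congr' fun _ => forall_congr' fun hε₁ => forall_congr' fun _ => forall_congr' fun V => forall_congr' fun _ =>
    and_congr Iff.rfl (and_congr Iff.rfl (reg910_regPinT_iff hρ hray C.B₃_pos hε₁ hMq V))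

/-- **NON-VACUITY AT OBJECTS — THE PIN IS EXERCISED**: at the trivial configuration `U = 1` the typed clause HOLDS at the pin on every cube with positive thresholds
(`U = 1` is gauged with optimal constant `0`: §1's `regConst_one`, n05-e's `toPV_one`). [cite: Balaban1985Variational, Thm 1 (9)–(10) p.279; Balaban1985RegularSpaces, p.98] -/
theorem regularity_regPinT_one {K k : ℕ} {ρ : ℝ} (hρ : 0 < ρ) (g : RegCubesT F K) {B₃ B₄ ε₁ : ℝ} (q : g.Q) (h₃ : 0 < B₃ * g.sizeM q * ε₁)
    (h₄ : 0 < B₄ * g.sizeM q * ε₁) :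
    B11.Regularity (varProblemT F N K k (regPinT F N K k ρ g)) B₃ B₄ ε₁ (1 : GaugeField (F.P K) 0 (SU N)) q := by
  letI : CStarAlgebra (Matrix (Fin N) (Fin N) ℂ) := B10Eq29TubeLine.cstarAlgebraMatrix N
  obtain ⟨hne, h0⟩ := regConst_one (T := fun μ => (LatticeFieldCalculus.shiftEquiv μ : Equiv.Perm (Site (F.P K) 0)))
    (𝔸 := Matrix (Fin N) (Fin N) ℂ) ((F.P K).eta k) (g.carrier q) (scaleLen_record_pos F K k (g.scale q)) g.dist hρ
  have hG : GaugedT F N K k ρ g 1 q := by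
    unfold GaugedT
    rw [B11Reg910Classes.toPV_one]
    exact hne
  have hc : regConstT F N K k ρ g 1 q = 0 := by
    unfold regConstT
    rw [B11Reg910Classes.toPV_one]
    exact h0
  refine regularity_regPinT_iff.2 ⟨hG, ?_, ?_⟩
  · rw [hc]; exact h₃
  · rw [hc, mul_zero]; exact h₄

/-- **DEGENERATE VALUE AT OBJECTS, PROVED ((w6))**: at a cube READ AS THE EMPTY SITE SET the typed clause HOLDS at the pin for EVERY configuration `U` as soon
as the thresholds are positive — it says nothing.  Hence the honest reading of every face above: the cube class `g` must come from print's (non-empty) cubes.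
[cite: Balaban1985Variational, (9)–(10) p.279 (bookkeeping)] -/
theorem regularity_regPinT_of_carrier_empty {K k : ℕ} {ρ : ℝ} {g : RegCubesT F K} {q : g.Q} (hq : g.carrier q = ∅) {B₃ B₄ ε₁ : ℝ}
    (h₃ : 0 < B₃ * g.sizeM q * ε₁) (h₄ : 0 < B₄ * g.sizeM q * ε₁) (U : GaugeField (F.P K) 0 (SU N)) :
    B11.Regularity (varProblemT F N K k (regPinT F N K k ρ g)) B₃ B₄ ε₁ U q := by
  obtain ⟨hne, h0⟩ := regConst_empty (T := fun μ => (LatticeFieldCalculus.shiftEquiv μ : Equiv.Perm (Site (F.P K) 0))) (U := toPV U)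
    ((F.P K).eta k) (scaleLen (F.L : ℝ) ((F.P K).eta k) (g.scale q)) g.dist ρ
  have hG : GaugedT F N K k ρ g U q := by
    unfold GaugedT
    rw [hq]
    exact hne
  have hc : regConstT F N K k ρ g U q = 0 := by
    unfold regConstT
    rw [hq]
    exact h0
  refine regularity_regPinT_iff.2 ⟨hG, ?_, ?_⟩
  · rw [hc]; exact h₃
  · rw [hc, mul_zero]; exact h₄

variable (N) in
/-- g3's geometry slot, FILLED by the cube class: the pin's `RegGeomT` reading. [cite: Balaban1985Variational, p.279 (bookkeeping)] -/
def RegCubesT.toRegGeomT {K : ℕ} (g : RegCubesT F K) (k : ℕ) (ρ : ℝ) : RegGeomT F N K (regPinT F N K k ρ g) :=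
  ⟨g.carrier, g.dist⟩

end Record

/-! ## §3. The pin on the residual layer; commutation with the pins of record; the headline; `t1` reads objects -/

section Layer

variable {F : T4Family} {N : ℕ} [NeZero N]
variable {L : ℝ} {η : ZIdx → ℝ} [Fact (0 < L)] [∀ i, Fact (0 < η i)] {β : ZIdx → Type} [∀ i, Fintype (β i)]

/-- ★ **THE REGULARITY-PINNED RESIDUAL LAYER**: `ζ` with its regularity data `R` REPLACED, member by member (`i = ⟨K, k, _⟩`), by the pin `regPinT F N K k ρ (g i)`
— ratio `ρ`, cube classes `g`; `IsCrit`, `famLG`, `famAn` and the twelve constants unchanged. [cite: Balaban1985Variational, Thm 1 (9)–(10) p.279] -/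
def ResidZ.pinReg (ζ : ResidZ F N) (ρ : ℝ) (g : ∀ i : ZIdx, RegCubesT F i.K) : ResidZ F N :=
  { ζ with R := fun i => regPinT F N i.K i.k ρ (g i) }

omit [NeZero N] in
/-- The pinned layer's regularity data ARE the pin (`rfl`). [cite: Balaban1985Variational, (9)–(10) p.279 (bookkeeping)] -/
theorem ResidZ.pinReg_R (ζ : ResidZ F N) (ρ : ℝ) (g : ∀ i : ZIdx, RegCubesT F i.K) :
    (ζ.pinReg ρ g).R = fun i => regPinT F N i.K i.k ρ (g i) := rfl

omit [NeZero N] in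
/-- The pin leaves the criticality predicate unchanged (`rfl`). [cite: Balaban1985Variational, Props 7–8 pp.299–300 (bookkeeping)] -/
theorem ResidZ.pinReg_IsCrit (ζ : ResidZ F N) (ρ : ℝ) (g : ∀ i : ZIdx, RegCubesT F i.K) : (ζ.pinReg ρ g).IsCrit = ζ.IsCrit := rfl

omit [NeZero N] in
/-- The pin leaves the Props 2–6 family unchanged (`rfl`). [cite: Balaban1985Variational, Props 2–6 pp.281–296 (bookkeeping)] -/
theorem ResidZ.pinReg_famLG (ζ : ResidZ F N) (ρ : ℝ) (g : ∀ i : ZIdx, RegCubesT F i.K) : (ζ.pinReg ρ g).famLG = ζ.famLG := rfl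

omit [NeZero N] in
/-- The pin leaves the Prop. 9 family unchanged (`rfl`). [cite: Balaban1985Variational, Prop. 9 pp.305–309 (bookkeeping)] -/
theorem ResidZ.pinReg_famAn (ζ : ResidZ F N) (ρ : ℝ) (g : ∀ i : ZIdx, RegCubesT F i.K) : (ζ.pinReg ρ g).famAn = ζ.famAn := rfl

omit [NeZero N] in
/-- The pin leaves the constants `B₀`, `B₃` (the two the Sect. E presentation reads) unchanged (`rfl`). [cite: Balaban1985Variational, (117), (162) (bookkeeping)] -/
theorem ResidZ.pinReg_B₀_B₃ (ζ : ResidZ F N) (ρ : ℝ) (g : ∀ i : ZIdx, RegCubesT F i.K) :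
    (ζ.pinReg ρ g).B₀ = ζ.B₀ ∧ (ζ.pinReg ρ g).B₃ = ζ.B₃ := ⟨rfl, rfl⟩

/-- The pinned layer's Theorem-1 family is n07-a's carrier AT THE PIN, member by member (`rfl`). [cite: Balaban1985Variational, Thm 1 p.279 (bookkeeping)] -/
theorem ResidZ.famVOfRecord_pinReg (ζ : ResidZ F N) (ρ : ℝ) (g : ∀ i : ZIdx, RegCubesT F i.K) (i : ZIdx) :
    famVOfRecord F N (ζ.pinReg ρ g) i = varProblemT F N i.K i.k (regPinT F N i.K i.k ρ (g i)) := rfl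

/-- **THE PIN COMMUTES WITH n07-e's CRITICALITY PIN** (`rfl`: they replace different fields). [cite: Balaban1985Variational, Props 7–8 pp.299–300 (bookkeeping)] -/
theorem ResidZ.pinReg_pinCrit (ζ : ResidZ F N) (ρ : ℝ) (g : ∀ i : ZIdx, RegCubesT F i.K) : (ζ.pinReg ρ g).pinCrit = ζ.pinCrit.pinReg ρ g := rfl

/-- **TRANSPORT OF A SECT. E PRESENTATION ACROSS THE PIN**: g2's `SectEPres` reads the layer only through `ζ.B₀`, `ζ.B₃`, which the pin leaves unchanged — the
same letters, data and `Rest` present the pinned layer. [cite: Balaban1985Variational, Sect. E (111)–(121) pp.293–296 (bookkeeping)] -/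
def SectEPres.pinReg {ζ : ResidZ F N} (E : SectEPres F N L η β ζ) (ρ : ℝ) (g : ∀ i : ZIdx, RegCubesT F i.K) : SectEPres F N L η β (ζ.pinReg ρ g) :=
  ⟨E.C₄, E.a₃, E.α, E.D, E.R⟩

omit [NeZero N] in
/-- **THE PIN COMMUTES WITH g2's SECT. E PRESENTATION** (`rfl`). [cite: Balaban1985Variational, Sect. E pp.293–296 (bookkeeping)] -/
theorem ResidZ.pinReg_withSectE (ζ : ResidZ F N) (E : SectEPres F N L η β ζ) (ρ : ℝ) (g : ∀ i : ZIdx, RegCubesT F i.K) :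
    (ζ.withSectE E).pinReg ρ g = (ζ.pinReg ρ g).withSectE (E.pinReg ρ g) := rfl

/-- ★★ **HEADLINE — AT THE REGULARITY-PINNED LAYER THE LEAF ALONE GIVES THEOREM 1's (9)–(10) AS PRINTED (∃u-form) AT NODE 00's OBJECTS**: for every member
`i = ⟨K, k, _⟩`, every `0 < ε₁ ≤ a₁`, every `V` with (7), every minimal configuration `U` of (5) over `𝔘_k(B₃ε₁) ∩ 𝔅_k(V)` and every cube `q` of the class `g i`
with `M ≤ M(ε₁)`: there is a gauge `u` of unitary type on `□ = (g i).carrier q` with `Uᵘ = e^{iηA}` and `|A| < B₃Mε₁ξ⁻¹`, `|∇^η A| < B₃Mε₁ξ⁻²`, Hölder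
`< B₄Mε₁ξ^{-(2+β)}` (`0 ≤ β ≤ 1`), `|∂^{η*}∂^η A|, |Δ^η A| < B₃Mε₁ξ⁻³`, `ξ = L^{scale q}η` — `CarriersZ.exists_thm1At_of_b11Leaf_Z11OfRecord` and §2's soundness
face; g3's `reg910T_of_b11Leaf_of_regSound` WITHOUT the displayed law `(hs : ζ.RegSound g)`. [cite: Balaban1985Variational, Thm 1 pp.278–279, (9)–(10)] -/
theorem reg910T_of_b11Leaf_pinReg {ζ : ResidZ F N} {ρ : ℝ} (hρ : 0 < ρ) {g : ∀ i : ZIdx, RegCubesT F i.K}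
    (h : B11Leaf (Z11OfRecord F N (ζ.pinReg ρ g))) :
    ∃ C : B11Thm1.Consts, ∀ (i : ZIdx) (ε₁ : ℝ), 0 < ε₁ → ε₁ ≤ C.a₁ → ∀ V : GaugeField (F.P i.K) i.k (SU N), PlaqSmall ε₁ V →
      ∀ U : GaugeField (F.P i.K) 0 (SU N), IsBackground (avOfRecord F N i.K) {U | InUkClassB11 F N i.K i.k (C.B₃ * ε₁) U} i.k V U →
        ∀ q : (g i).Q, (g i).sizeM q ≤ C.Mfun ε₁ →
          Reg910T F N i.K i.k U ((g i).carrier q) ((g i).scale q) (g i).dist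
            (C.B₃ * (g i).sizeM q * ε₁) (C.B₄ * (g i).sizeM q * ε₁) 1 := by
  obtain ⟨C, hC⟩ := exists_thm1At_of_b11Leaf_Z11OfRecord h
  refine ⟨C, fun i ε₁ h₁ h₂ V hV U hU q hq => ?_⟩
  obtain ⟨-, -, h910⟩ := hC i ε₁ h₁ h₂ V hV
  exact reg910T_of_regularity_regPinT hρ (h910 U hU q hq)

/-- The headline at the TRIPLY-PINNED layer `((ζ.withSectE E).pinCrit).pinReg ρ g` (Sect. E presentation, criticality of record, regularity pin) a N07 closer
may read. [cite: Balaban1985Variational, Thm 1 pp.278–279, (9)–(10) (bookkeeping)] -/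
theorem reg910T_of_b11Leaf_withSectE_pinCrit_pinReg {ζ : ResidZ F N} {ρ : ℝ} (hρ : 0 < ρ) {g : ∀ i : ZIdx, RegCubesT F i.K}
    (E : SectEPres F N L η β ζ) (h : B11Leaf (Z11OfRecord F N (((ζ.withSectE E).pinCrit).pinReg ρ g))) :
    ∃ C : B11Thm1.Consts, ∀ (i : ZIdx) (ε₁ : ℝ), 0 < ε₁ → ε₁ ≤ C.a₁ → ∀ V : GaugeField (F.P i.K) i.k (SU N), PlaqSmall ε₁ V →
      ∀ U : GaugeField (F.P i.K) 0 (SU N), IsBackground (avOfRecord F N i.K) {U | InUkClassB11 F N i.K i.k (C.B₃ * ε₁) U} i.k V U →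
        ∀ q : (g i).Q, (g i).sizeM q ≤ C.Mfun ε₁ →
          Reg910T F N i.K i.k U ((g i).carrier q) ((g i).scale q) (g i).dist
            (C.B₃ * (g i).sizeM q * ε₁) (C.B₄ * (g i).sizeM q * ε₁) 1 :=
  reg910T_of_b11Leaf_pinReg (ζ := (ζ.withSectE E).pinCrit) hρ h

/-- ★★★ **AT THE PINNED LAYER, `t1` READS OBJECTS** (cube classes with `sizeM > 0`): the leaf's Theorem-1 conjunct `B11.Thm1Printed` at the pinned layer's family
(`(Z11OfRecord F N (ζ.pinReg ρ g)).famV = famVOfRecord F N (ζ.pinReg ρ g)`, `rfl`) IS EQUIVALENT TO «there are constants `C` ON THE RAY `C.B₄ = ρ·C.B₃` such that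
every member satisfies, for every `0 < ε₁ ≤ a₁` and `V` with (7): (8), uniqueness in (6) (by name), and print's (9)–(10) in the ∃u-form for every minimal `U` and cube
with `M ≤ M(ε₁)`» — the junk channel of the ∀-form through the regularity data (`CarriersZ.exists_residZ_not_b11Leaf`) is CLOSED at the pin (`⇒`: move any block of
constants onto the ray, `thm1At_regPinT_onRay`; `⇐`: exactness on the ray). [cite: Balaban1985Variational, Thm 1 pp.278–279] -/
theorem thm1Printed_famV_pinReg_iff {ζ : ResidZ F N} {ρ : ℝ} (hρ : 0 < ρ) {g : ∀ i : ZIdx, RegCubesT F i.K}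
    (hMq : ∀ (i : ZIdx) (q : (g i).Q), 0 < (g i).sizeM q) :
    B11.Thm1Printed (famVOfRecord F N (ζ.pinReg ρ g)) ↔
      ∃ C : B11Thm1.Consts, C.B₄ = ρ * C.B₃ ∧ ∀ (i : ZIdx) (ε₁ : ℝ), 0 < ε₁ → ε₁ ≤ C.a₁ →
        ∀ V : GaugeField (F.P i.K) i.k (SU N), PlaqSmall ε₁ V →
          Exists8 (varProblemT F N i.K i.k (regPinT F N i.K i.k ρ (g i))) C.B₃ ε₁ V ∧
          Unique6 (varProblemT F N i.K i.k (regPinT F N i.K i.k ρ (g i))) C.a₀ C.B₃ ε₁ V ∧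
          ∀ U : GaugeField (F.P i.K) 0 (SU N), IsBackground (avOfRecord F N i.K) {U | InUkClassB11 F N i.K i.k (C.B₃ * ε₁) U} i.k V U →
            ∀ q : (g i).Q, (g i).sizeM q ≤ C.Mfun ε₁ →
              Reg910T F N i.K i.k U ((g i).carrier q) ((g i).scale q) (g i).dist
                (C.B₃ * (g i).sizeM q * ε₁) (C.B₄ * (g i).sizeM q * ε₁) 1 := by
  refine (B11Thm1CarrierT.thm1Printed_iff_thm1At (F := F) (N := N) (fun i : ZIdx => i.K) (fun i => i.k)
    (fun i => regPinT F N i.K i.k ρ (g i))).trans ⟨?_, ?_⟩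
  · rintro ⟨C, hC⟩
    exact ⟨constsOnRay C ρ hρ, rfl, fun i => (thm1At_regPinT_iff hρ (constsOnRay C ρ hρ) rfl (hMq i)).1 (thm1At_regPinT_onRay hρ (hC i))⟩
  · rintro ⟨C, hray, H⟩
    exact ⟨C, fun i => (thm1At_regPinT_iff hρ C hray (hMq i)).2 (H i)⟩

end Layer

end Literature.MathematicalPhysics.QuantumFieldTheory.Balaban1983to89.Node00
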